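import Mathlib
import HarnessLib
import Summits.CriticalPhenomena.PercolationContinuityZ3.Theses.PercLowPointHalfSpace
import Summits.CriticalPhenomena.PercolationContinuityZ3.Theorems.PercLowPointHalfSpaceLowPointBookkeepingLevelCount
import Summits.CriticalPhenomena.PercolationContinuityZ3.Theorems.PercLowPointHalfSpaceLowPointBookkeepingCubeExit
import Summits.CriticalPhenomena.PercolationContinuityZ3.Theorems.PercLowPointHalfSpaceLowPointBookkeepingStemDyadic
import Summits.CriticalPhenomena.PercolationContinuityZ3.Theorems.PercLowPointHalfSpaceLowPointBookkeepingStemComposition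
import Summits.CriticalPhenomena.PercolationContinuityZ3.Theorems.PercLowPointHalfSpaceLowPointBookkeepingStemLevel

/-!
# Crux `LowPointBookkeeping` (stmt-CriticalPhenomena-14713), line `SketchIdeator4`: the STEM CRITERION,
# the restatement-R6 assembly, its negative side, and the crux from the two route-level inputs

Helper file for the crux item `stmt-CriticalPhenomena-14713` (`LowPointBookkeeping`, K := A → B → C →
`P_{p_c}(0 ↔ n e₀) → 0`) of route `CriticalPhenomena/PercLowPointHalfSpace` (lands `--supports`, registered
sub-goal `stub_stemCriterion`; lead a1).  It assembles the four LANDED lemma stubs of the line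
(`stub_cubeExit`, `stub_stemLevel`, `stub_dyadic`, `stub_composition`) into sorry-free theorems:

* `stub_stemCriterion` / `stemCriterion` — **THE STEM CRITERION** (unconditional, every `φ ≥ 0`, `R ≥ 1`):
  `θ(p_c) · R ≤ 6 · [R^{-φ} · Σ_{x ∈ B_{4R}} P(0 ↔_ℍ x, arm_R) + Σ_{x ∈ B_{2R}} P(0 ↔_ℍ x, arm_R, locFoot_R < (2R)^φ)]`
  (bond percolation on `ℤ³` at `p_c`, `ℍ = {0 ≤ x₀}`, `arm_R` the route's arm event, `locFoot_R` the local
  footprint of the wall cluster `U = C_ℍ(0)`): a jump world must carry its infinite-cluster density, at every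
  scale, either on FAT-footed level mass (gain `R^{-φ}`) or on THIN-STEMMED tall wall clusters;
* `percolationContinuityZ3_of_stemInputs` — the ASSEMBLY of the card's restatement R6, PROVED:
  `Bwide → QuantC a → StemLight φ → 0 ≤ φ → 7/4 < a + φ → θ(p_c(ℤ³)) = 0`;
* `not_stemLight_of_discontinuity` — the NEGATIVE SIDE: in a discontinuous world with `Bwide` and `QuantC a`,
  `StemLight φ` fails for every `φ ≥ 0` with `a + φ > 7/4` (thin stems carry density `≥ θ/6` infinitely often);
* `lowPointBookkeeping_of_stemInputs` — the crux K from the two HYPOTHESIS-STUBS of the skeleton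
  (`B → Bwide` and `∃ a φ, 0 ≤ φ ∧ 7/4 < a + φ ∧ (C → QuantC a) ∧ StemLight φ`) stated as explicit hypotheses:
  exactly what the line leaves open (route-level inputs, not lemmas from A, B, C);
* `percolationContinuityZ3_of_stemInputs_exp` — the same with a GENERAL wide-ball mass exponent `m` and the exchange
  rate `m - 1 < a + φ` (so a sharper B buys stem depth: with exact exponents the condition is `δ < x_h`);
* `stemLight_anti` — `StemLight` is antitone in the depth `φ` (nested thin-stem events);
* the endpoint `φ = 0` (`stemLight_zero`, `percolationContinuityZ3_of_bwide_of_quantC`): `StemLight 0` is trivial (the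
  origin is its own local foot), so `Bwide ∧ QuantC a ∧ a > 7/4 ⇒ θ(p_c) = 0` — the exchange rate `m - 1 < a`;
* dominance: `Bwide ⇒ B` (`tallClusterMassBound_of_bwide`), `QuantC a ∧ a > 0 ⇒ C` (`quantitativeBGN_of_quantC`).

References: card `Cruxes/LowPointBookkeeping/Ideas/cube-exit-stem-criterion.md`, `FindingsIdeator4.md` §1;
R. Lyons – Y. Peres (2016) §8.2; G. Grimmett, *Percolation* (1999) §1.4, §1.6, §8.5.
-/

noncomputable section

open MeasureTheory Filter Topology
open Literature.Probability.Percolation Literature.Probability.LatticeModels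
open scoped ENNReal Classical

namespace Summit.CriticalPhenomena.PercolationContinuityZ3.Theorems.StemCriterion

open Summit.CriticalPhenomena.PercolationContinuityZ3.Theses.PercLowPointHalfSpace

/-! ## The stem criterion -/

/-- **Registered sub-goal `stub_stemCriterion` — THE STEM CRITERION** (unconditional): for every depth `φ ≥ 0`
and scale `R ≥ 1`,
`θ(p_c) · R ≤ 6 · [R^{-φ} · Σ_{x ∈ B_{4R}} P(0 ↔_ℍ x, arm_R) + Σ_{x ∈ B_{2R}} P(0 ↔_ℍ x, arm_R, locFoot_R < (2R)^φ)]`.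
Cube exit (`stub_cubeExit`) + the per-level stem inequality (`stub_stemLevel`) summed dyadically (`stub_dyadic`).
[folklore] -/
theorem stub_stemCriterion : ∀ φ : ℝ, 0 ≤ φ → ∀ R : ℕ, 1 ≤ R → theta (zdGraph 3) (0 : Site 3) (criticalProbI 3) * R ≤ 6 * ((R : ℝ) ^ (-φ) * ∑ x ∈ box 3 (4 * R), (bondPercolation (zdGraph 3) (criticalProbI 3)).real (openConnIn {x : Site 3 | 0 ≤ x 0} 0 x ∩ {ω | ∃ y : Site 3, (∃ i : Fin 3, (R : ℤ) ≤ |y i|) ∧ ω ∈ openConnIn {x : Site 3 | 0 ≤ x 0} 0 y}) + ∑ x ∈ box 3 (2 * R), (bondPercolation (zdGraph 3) (criticalProbI 3)).real (openConnIn {x : Site 3 | 0 ≤ x 0} 0 x ∩ {ω | ∃ y : Site 3, (∃ i : Fin 3, (R : ℤ) ≤ |y i|) ∧ ω ∈ openConnIn {x : Site 3 | 0 ≤ x 0} 0 y} ∩ {ω | ((((box 3 R).filter fun g : Site 3 => g 0 = 0 ∧ ω ∈ openConnIn ((↑(box 3 R) : Set (Site 3)) ∩ {x : Site 3 | 0 ≤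 x 0}) 0 g).card : ℕ) : ℝ) < (2 * (R : ℝ)) ^ φ})) :=
  stub_dyadic (fun r => stub_cubeExit (criticalProbI 3) r) (fun r hr t ht => stub_stemLevel (criticalProbI 3) r hr t ht)

/-- **The stem criterion** (readable alias of `stub_stemCriterion`). [folklore] -/
theorem stemCriterion {φ : ℝ} (hφ : 0 ≤ φ) {R : ℕ} (hR : 1 ≤ R) :
    theta (zdGraph 3) (0 : Site 3) (criticalProbI 3) * R ≤
      6 * ((R : ℝ) ^ (-φ) * ∑ x ∈ box 3 (4 * R), (bondPercolation (zdGraph 3) (criticalProbI 3)).real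
          (openConnIn {x : Site 3 | 0 ≤ x 0} 0 x ∩
            {ω | ∃ y : Site 3, (∃ i : Fin 3, (R : ℤ) ≤ |y i|) ∧ ω ∈ openConnIn {x : Site 3 | 0 ≤ x 0} 0 y}) +
        ∑ x ∈ box 3 (2 * R), (bondPercolation (zdGraph 3) (criticalProbI 3)).real
          (openConnIn {x : Site 3 | 0 ≤ x 0} 0 x ∩
            {ω | ∃ y : Site 3, (∃ i : Fin 3, (R : ℤ) ≤ |y i|) ∧ ω ∈ openConnIn {x : Site 3 | 0 ≤ x 0} 0 y} ∩
            {ω | ((((box 3 R).filter fun g : Site 3 => g 0 = 0 ∧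
              ω ∈ openConnIn ((↑(box 3 R) : Set (Site 3)) ∩ {x : Site 3 | 0 ≤ x 0}) 0 g).card : ℕ) : ℝ) <
                (2 * (R : ℝ)) ^ φ})) :=
  stub_stemCriterion φ hφ R hR

/-! ## Restatement R6: the assembly, proved -/

/-- **R6 assembly** (`Bwide → QuantC a → StemLight φ → 0 ≤ φ → 7/4 < a + φ → θ(p_c(ℤ³)) = 0`): B re-typed on the
4×-ball, C with the named exponent `a`, and "thin-stemmed tall wall clusters carry vanishing level density" give
the conjunct, by the stem criterion and `stub_composition`. [folklore] -/
theorem percolationContinuityZ3_of_stemInputs {a φ : ℝ} (hφ : 0 ≤ φ) (haφ : (7 : ℝ) / 4 < a + φ)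
    (hBw : ∃ C : ℝ, ∀ r : ℕ, 1 ≤ r → ∑ x ∈ box 3 (4 * r), (bondPercolation (zdGraph 3) (criticalProbI 3)).real
      (openConnIn {x : Site 3 | 0 ≤ x 0} 0 x ∩
        {ω | ∃ y : Site 3, (∃ i : Fin 3, (r : ℤ) ≤ |y i|) ∧ ω ∈ openConnIn {x : Site 3 | 0 ≤ x 0} 0 y}) ≤
      C * (r : ℝ) ^ ((11 : ℝ) / 4) * (bondPercolation (zdGraph 3) (criticalProbI 3)).real
        {ω | ∃ y : Site 3, (∃ i : Fin 3, (r : ℤ) ≤ |y i|) ∧ ω ∈ openConnIn {x : Site 3 | 0 ≤ x 0} 0 y})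
    (hQ : ∃ C : ℝ, ∀ r : ℕ, 1 ≤ r → (bondPercolation (zdGraph 3) (criticalProbI 3)).real
      {ω | ∃ y : Site 3, (∃ i : Fin 3, (r : ℤ) ≤ |y i|) ∧ ω ∈ openConnIn {x : Site 3 | 0 ≤ x 0} 0 y} ≤
        C * (r : ℝ) ^ (-a))
    (hS : Tendsto (fun R : ℕ => (R : ℝ)⁻¹ * ∑ x ∈ box 3 (2 * R), (bondPercolation (zdGraph 3) (criticalProbI 3)).real
      (openConnIn {x : Site 3 | 0 ≤ x 0} 0 x ∩
        {ω | ∃ y : Site 3, (∃ i : Fin 3, (R : ℤ) ≤ |y i|) ∧ ω ∈ openConnIn {x : Site 3 | 0 ≤ x 0} 0 y} ∩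
        {ω | ((((box 3 R).filter fun g : Site 3 => g 0 = 0 ∧
          ω ∈ openConnIn ((↑(box 3 R) : Set (Site 3)) ∩ {x : Site 3 | 0 ≤ x 0}) 0 g).card : ℕ) : ℝ) <
            (2 * (R : ℝ)) ^ φ})) atTop (𝓝 0)) :
    _root_.PercolationContinuityZ3 :=
  stub_composition a φ hφ haφ (stub_stemCriterion φ hφ) hBw hQ hS

/-- **Negative side of the stem criterion**: in a DISCONTINUOUS world (`θ(p_c(ℤ³)) > 0`) satisfying `Bwide` and
`QuantC a`, thin-stemmed tall wall clusters must carry non-vanishing level density at every admissible depth: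
`StemLight φ` fails for every `φ ≥ 0` with `a + φ > 7/4`. [folklore] -/
theorem not_stemLight_of_discontinuity {a φ : ℝ} (hφ : 0 ≤ φ) (haφ : (7 : ℝ) / 4 < a + φ)
    (hBw : ∃ C : ℝ, ∀ r : ℕ, 1 ≤ r → ∑ x ∈ box 3 (4 * r), (bondPercolation (zdGraph 3) (criticalProbI 3)).real
      (openConnIn {x : Site 3 | 0 ≤ x 0} 0 x ∩
        {ω | ∃ y : Site 3, (∃ i : Fin 3, (r : ℤ) ≤ |y i|) ∧ ω ∈ openConnIn {x : Site 3 | 0 ≤ x 0} 0 y}) ≤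
      C * (r : ℝ) ^ ((11 : ℝ) / 4) * (bondPercolation (zdGraph 3) (criticalProbI 3)).real
        {ω | ∃ y : Site 3, (∃ i : Fin 3, (r : ℤ) ≤ |y i|) ∧ ω ∈ openConnIn {x : Site 3 | 0 ≤ x 0} 0 y})
    (hQ : ∃ C : ℝ, ∀ r : ℕ, 1 ≤ r → (bondPercolation (zdGraph 3) (criticalProbI 3)).real
      {ω | ∃ y : Site 3, (∃ i : Fin 3, (r : ℤ) ≤ |y i|) ∧ ω ∈ openConnIn {x : Site 3 | 0 ≤ x 0} 0 y} ≤
        C * (r : ℝ) ^ (-a))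
    (hjump : ¬ _root_.PercolationContinuityZ3) :
    ¬ Tendsto (fun R : ℕ => (R : ℝ)⁻¹ * ∑ x ∈ box 3 (2 * R), (bondPercolation (zdGraph 3) (criticalProbI 3)).real
      (openConnIn {x : Site 3 | 0 ≤ x 0} 0 x ∩
        {ω | ∃ y : Site 3, (∃ i : Fin 3, (R : ℤ) ≤ |y i|) ∧ ω ∈ openConnIn {x : Site 3 | 0 ≤ x 0} 0 y} ∩
        {ω | ((((box 3 R).filter fun g : Site 3 => g 0 = 0 ∧
          ω ∈ openConnIn ((↑(box 3 R) : Set (Site 3)) ∩ {x : Site 3 | 0 ≤ x 0}) 0 g).card : ℕ) : ℝ) <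
            (2 * (R : ℝ)) ^ φ})) atTop (𝓝 0) :=
  fun hS => hjump (percolationContinuityZ3_of_stemInputs hφ haφ hBw hQ hS)

/-! ## General mass exponent: the exchange rate `m - 1 < a + φ` -/

namespace General

/-- Merging the powers: for `r > 0`, `r⁻¹ · r^{-φ} · r^{m} · r^{-a} = r^{-(a + φ + 1 - m)}`. [folklore] -/
theorem rpow_merge {r : ℝ} (hr : 0 < r) (m a φ : ℝ) :
    r⁻¹ * r ^ (-φ) * r ^ m * r ^ (-a) = r ^ (-(a + φ + 1 - m)) := by
  rw [← Real.rpow_neg_one, ← Real.rpow_add hr, ← Real.rpow_add hr, ← Real.rpow_add hr]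
  congr 1
  ring

/-- The bound at one scale `R ≥ 1` with nonnegative constants and mass exponent `m`:
`θ ≤ 6 C C' R^{-(a + φ + 1 - m)} + 6 R⁻¹ T(R)`. [folklore] -/
theorem pointwise_bound {θ m a φ C C' : ℝ} {F T P : ℕ → ℝ} (hC : 0 ≤ C) {R : ℕ} (hR : 1 ≤ R)
    (hSC : θ * R ≤ 6 * ((R : ℝ) ^ (-φ) * F R + T R))
    (hB : F R ≤ C * (R : ℝ) ^ m * P R) (hQ : P R ≤ C' * (R : ℝ) ^ (-a)) :
    θ ≤ 6 * (C * C') * (R : ℝ) ^ (-(a + φ + 1 - m)) + 6 * ((R : ℝ)⁻¹ * T R) := by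
  have hr : (0 : ℝ) < R := by exact_mod_cast hR
  have h1 : θ ≤ (R : ℝ)⁻¹ * (6 * ((R : ℝ) ^ (-φ) * F R + T R)) := by
    rw [← div_eq_inv_mul, le_div_iff₀ hr]
    exact hSC
  have h2 : (R : ℝ) ^ (-φ) * F R ≤ (R : ℝ) ^ (-φ) * (C * (R : ℝ) ^ m * (C' * (R : ℝ) ^ (-a))) :=
    mul_le_mul_of_nonneg_left
      (hB.trans (mul_le_mul_of_nonneg_left hQ (mul_nonneg hC (Real.rpow_nonneg hr.le _))))
      (Real.rpow_nonneg hr.le _)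
  calc θ ≤ (R : ℝ)⁻¹ * (6 * ((R : ℝ) ^ (-φ) * F R + T R)) := h1
    _ ≤ (R : ℝ)⁻¹ * (6 * ((R : ℝ) ^ (-φ) * (C * (R : ℝ) ^ m * (C' * (R : ℝ) ^ (-a))) + T R)) :=
        mul_le_mul_of_nonneg_left (by linarith) (inv_nonneg.2 hr.le)
    _ = 6 * (C * C') * ((R : ℝ)⁻¹ * (R : ℝ) ^ (-φ) * (R : ℝ) ^ m * (R : ℝ) ^ (-a)) + 6 * ((R : ℝ)⁻¹ * T R) := by
        ring
    _ = 6 * (C * C') * (R : ℝ) ^ (-(a + φ + 1 - m)) + 6 * ((R : ℝ)⁻¹ * T R) := by rw [rpow_merge hr]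

/-- **Abstract composition with a general mass exponent `m`.**  If `θ ≥ 0`, `P ≥ 0`, `m - 1 < a + φ`, and for all
`R ≥ 1`: `θ R ≤ 6 (R^{-φ} F(R) + T(R))`, `F(R) ≤ C R^{m} P(R)`, `P(R) ≤ C' R^{-a}`, while `R⁻¹ T(R) → 0`, then `θ = 0`.
[folklore] -/
theorem const_eq_zero_of_bound {θ m a φ : ℝ} {F T P : ℕ → ℝ} (hθ : 0 ≤ θ)
    (h : m - 1 < a + φ) (hP : ∀ R, 0 ≤ P R)
    (hSC : ∀ R : ℕ, 1 ≤ R → θ * R ≤ 6 * ((R : ℝ) ^ (-φ) * F R + T R))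
    (hB : ∃ C : ℝ, ∀ R : ℕ, 1 ≤ R → F R ≤ C * (R : ℝ) ^ m * P R)
    (hQ : ∃ C : ℝ, ∀ R : ℕ, 1 ≤ R → P R ≤ C * (R : ℝ) ^ (-a))
    (hS : Tendsto (fun R : ℕ => (R : ℝ)⁻¹ * T R) atTop (𝓝 0)) : θ = 0 := by
  obtain ⟨C, hC⟩ := hB
  obtain ⟨C', hC'⟩ := hQ
  have hB' : ∀ R : ℕ, 1 ≤ R → F R ≤ max C 0 * (R : ℝ) ^ m * P R := fun R hR =>
    (hC R hR).trans (by
      rw [mul_assoc, mul_assoc]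
      exact mul_le_mul_of_nonneg_right (le_max_left _ _)
        (mul_nonneg (Real.rpow_nonneg (Nat.cast_nonneg _) _) (hP R)))
  have hQ' : ∀ R : ℕ, 1 ≤ R → P R ≤ max C' 0 * (R : ℝ) ^ (-a) := fun R hR =>
    (hC' R hR).trans
      (mul_le_mul_of_nonneg_right (le_max_left _ _) (Real.rpow_nonneg (Nat.cast_nonneg _) _))
  have hpow : Tendsto (fun R : ℕ => (R : ℝ) ^ (-(a + φ + 1 - m))) atTop (𝓝 0) :=
    (tendsto_rpow_neg_atTop (by linarith)).comp tendsto_natCast_atTop_atTop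
  have hlim : Tendsto (fun R : ℕ => 6 * (max C 0 * max C' 0) * (R : ℝ) ^ (-(a + φ + 1 - m))
      + 6 * ((R : ℝ)⁻¹ * T R)) atTop (𝓝 0) := by
    have h' := (hpow.const_mul (6 * (max C 0 * max C' 0))).add (hS.const_mul 6)
    simp only [mul_zero, add_zero] at h'
    exact h'
  have hle : θ ≤ 0 :=
    ge_of_tendsto hlim (Filter.eventually_atTop.2 ⟨1, fun R hR =>
      pointwise_bound (le_max_right _ _) hR (hSC R hR) (hB' R hR) (hQ' R hR)⟩)
  exact le_antisymm hle hθ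

end General

/-- **R6 with a general mass exponent** (the exchange rate of the criterion): if tall wall clusters have wide-ball
mass exponent `m` (`Σ_{x ∈ B_{4r}} P(0 ↔_ℍ x, arm_r) ≤ C r^{m} P(arm_r)`), the half-space one-arm decays with exponent
`a`, and `StemLight φ` holds at a depth `φ ≥ 0` with `m - 1 < a + φ`, then `θ(p_c(ℤ³)) = 0`.  With the true exponents
`m = d_f`, `a = x_s` and `φ = φ_typ - δ = 2 - x_s - δ` the condition reads `δ < 3 - d_f = x_h` (card, item (2)).
[folklore] -/
theorem percolationContinuityZ3_of_stemInputs_exp {m a φ : ℝ} (hφ : 0 ≤ φ) (h : m - 1 < a + φ)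
    (hBw : ∃ C : ℝ, ∀ r : ℕ, 1 ≤ r → ∑ x ∈ box 3 (4 * r), (bondPercolation (zdGraph 3) (criticalProbI 3)).real
      (openConnIn {x : Site 3 | 0 ≤ x 0} 0 x ∩
        {ω | ∃ y : Site 3, (∃ i : Fin 3, (r : ℤ) ≤ |y i|) ∧ ω ∈ openConnIn {x : Site 3 | 0 ≤ x 0} 0 y}) ≤
      C * (r : ℝ) ^ m * (bondPercolation (zdGraph 3) (criticalProbI 3)).real
        {ω | ∃ y : Site 3, (∃ i : Fin 3, (r : ℤ) ≤ |y i|) ∧ ω ∈ openConnIn {x : Site 3 | 0 ≤ x 0} 0 y})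
    (hQ : ∃ C : ℝ, ∀ r : ℕ, 1 ≤ r → (bondPercolation (zdGraph 3) (criticalProbI 3)).real
      {ω | ∃ y : Site 3, (∃ i : Fin 3, (r : ℤ) ≤ |y i|) ∧ ω ∈ openConnIn {x : Site 3 | 0 ≤ x 0} 0 y} ≤
        C * (r : ℝ) ^ (-a))
    (hS : Tendsto (fun R : ℕ => (R : ℝ)⁻¹ * ∑ x ∈ box 3 (2 * R), (bondPercolation (zdGraph 3) (criticalProbI 3)).real
      (openConnIn {x : Site 3 | 0 ≤ x 0} 0 x ∩
        {ω | ∃ y : Site 3, (∃ i : Fin 3, (R : ℤ) ≤ |y i|) ∧ ω ∈ openConnIn {x : Site 3 | 0 ≤ x 0} 0 y} ∩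
        {ω | ((((box 3 R).filter fun g : Site 3 => g 0 = 0 ∧
          ω ∈ openConnIn ((↑(box 3 R) : Set (Site 3)) ∩ {x : Site 3 | 0 ≤ x 0}) 0 g).card : ℕ) : ℝ) <
            (2 * (R : ℝ)) ^ φ})) atTop (𝓝 0)) :
    _root_.PercolationContinuityZ3 :=
  General.const_eq_zero_of_bound (by unfold theta; exact measureReal_nonneg) h (fun _ => measureReal_nonneg)
    (stub_stemCriterion φ hφ) hBw hQ hS

/-! ## The endpoint `φ = 0`: continuity from `Bwide` and a boundary one-arm exponent `a > 7/4` -/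

/-- At depth `φ = 0` the thin-stem event is EMPTY — the origin is always one of its own local feet, so
`locFoot_R ≥ 1 = (2R)^0` — hence `StemLight 0` holds trivially. [folklore] -/
theorem stemLight_zero : Tendsto (fun R : ℕ => (R : ℝ)⁻¹ * ∑ x ∈ box 3 (2 * R),
    (bondPercolation (zdGraph 3) (criticalProbI 3)).real (openConnIn {x : Site 3 | 0 ≤ x 0} 0 x ∩
      {ω | ∃ y : Site 3, (∃ i : Fin 3, (R : ℤ) ≤ |y i|) ∧ ω ∈ openConnIn {x : Site 3 | 0 ≤ x 0} 0 y} ∩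
      {ω | ((((box 3 R).filter fun g : Site 3 => g 0 = 0 ∧
        ω ∈ openConnIn ((↑(box 3 R) : Set (Site 3)) ∩ {x : Site 3 | 0 ≤ x 0}) 0 g).card : ℕ) : ℝ) <
          (2 * (R : ℝ)) ^ (0 : ℝ)})) atTop (𝓝 0) := by
  have hfoot : ∀ (R : ℕ) (ω : BondConfig (Site 3)), 1 ≤ ((box 3 R).filter fun g : Site 3 => g 0 = 0 ∧
      ω ∈ openConnIn ((↑(box 3 R) : Set (Site 3)) ∩ {x : Site 3 | 0 ≤ x 0}) 0 g).card := by
    intro R ω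
    refine Finset.card_pos.2 ⟨0, Finset.mem_filter.2 ⟨?_, rfl, ?_⟩⟩
    · simp [mem_box]
    · have h0 : (0 : Site 3) ∈ (↑(box 3 R) : Set (Site 3)) ∩ {x : Site 3 | 0 ≤ x 0} :=
        ⟨by simp [mem_box], show (0 : ℤ) ≤ 0 from le_rfl⟩
      exact ⟨h0, h0, SimpleGraph.Reachable.refl _⟩
  have hzero : (fun R : ℕ => (R : ℝ)⁻¹ * ∑ x ∈ box 3 (2 * R),
      (bondPercolation (zdGraph 3) (criticalProbI 3)).real (openConnIn {x : Site 3 | 0 ≤ x 0} 0 x ∩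
        {ω | ∃ y : Site 3, (∃ i : Fin 3, (R : ℤ) ≤ |y i|) ∧ ω ∈ openConnIn {x : Site 3 | 0 ≤ x 0} 0 y} ∩
        {ω | ((((box 3 R).filter fun g : Site 3 => g 0 = 0 ∧
          ω ∈ openConnIn ((↑(box 3 R) : Set (Site 3)) ∩ {x : Site 3 | 0 ≤ x 0}) 0 g).card : ℕ) : ℝ) <
            (2 * (R : ℝ)) ^ (0 : ℝ)})) = fun _ => 0 := by
    funext R
    rw [Finset.sum_eq_zero fun x _ => ?_, mul_zero]
    convert measureReal_empty (μ := bondPercolation (zdGraph 3) (criticalProbI 3)) using 2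
    refine Set.eq_empty_of_forall_notMem fun ω hω => ?_
    have h1 := hω.2
    simp only [Set.mem_setOf_eq, Real.rpow_zero] at h1
    have h2 := hfoot R ω
    exact absurd h1 (not_lt.2 (by exact_mod_cast h2))
  rw [hzero]
  exact tendsto_const_nhds

/-- **Continuity from `Bwide` and a boundary one-arm exponent `a > 7/4`** (the endpoint `φ = 0` of R6): if tall wall
clusters are thin on the wide ball (`Bwide`, exponent `11/4`) and the half-space one-arm probability decays like
`r^{-a}` with `a > 7/4 = 11/4 - 1`, then `θ(p_c(ℤ³)) = 0`.  (Numerically `a = x_s ≈ 0.975`, so this endpoint is not the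
real world; it records the exchange rate `m - 1 < a` of the criterion.) [folklore] -/
theorem percolationContinuityZ3_of_bwide_of_quantC {a : ℝ} (ha : (7 : ℝ) / 4 < a)
    (hBw : ∃ C : ℝ, ∀ r : ℕ, 1 ≤ r → ∑ x ∈ box 3 (4 * r), (bondPercolation (zdGraph 3) (criticalProbI 3)).real
      (openConnIn {x : Site 3 | 0 ≤ x 0} 0 x ∩
        {ω | ∃ y : Site 3, (∃ i : Fin 3, (r : ℤ) ≤ |y i|) ∧ ω ∈ openConnIn {x : Site 3 | 0 ≤ x 0} 0 y}) ≤
      C * (r : ℝ) ^ ((11 : ℝ) / 4) * (bondPercolation (zdGraph 3) (criticalProbI 3)).real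
        {ω | ∃ y : Site 3, (∃ i : Fin 3, (r : ℤ) ≤ |y i|) ∧ ω ∈ openConnIn {x : Site 3 | 0 ≤ x 0} 0 y})
    (hQ : ∃ C : ℝ, ∀ r : ℕ, 1 ≤ r → (bondPercolation (zdGraph 3) (criticalProbI 3)).real
      {ω | ∃ y : Site 3, (∃ i : Fin 3, (r : ℤ) ≤ |y i|) ∧ ω ∈ openConnIn {x : Site 3 | 0 ≤ x 0} 0 y} ≤
        C * (r : ℝ) ^ (-a)) :
    _root_.PercolationContinuityZ3 :=
  percolationContinuityZ3_of_stemInputs (φ := 0) le_rfl (by linarith) hBw hQ stemLight_zero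

/-! ## Monotonicity of `StemLight` in the depth -/

/-- **`StemLight` is antitone in the depth**: a larger `φ` declares more clusters thin, so `StemLight φ' ⇒ StemLight φ`
for `φ ≤ φ'` (squeeze; the thin-stem events are nested for `R ≥ 1`).  Hence the admissible region
`{(a, φ) | QuantC a ∧ StemLight φ}` is a down-set in `φ` (and in `a`). [folklore] -/
theorem stemLight_anti {φ φ' : ℝ} (hle : φ ≤ φ')
    (hS : Tendsto (fun R : ℕ => (R : ℝ)⁻¹ * ∑ x ∈ box 3 (2 * R), (bondPercolation (zdGraph 3) (criticalProbI 3)).real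
      (openConnIn {x : Site 3 | 0 ≤ x 0} 0 x ∩
        {ω | ∃ y : Site 3, (∃ i : Fin 3, (R : ℤ) ≤ |y i|) ∧ ω ∈ openConnIn {x : Site 3 | 0 ≤ x 0} 0 y} ∩
        {ω | ((((box 3 R).filter fun g : Site 3 => g 0 = 0 ∧
          ω ∈ openConnIn ((↑(box 3 R) : Set (Site 3)) ∩ {x : Site 3 | 0 ≤ x 0}) 0 g).card : ℕ) : ℝ) <
            (2 * (R : ℝ)) ^ φ'})) atTop (𝓝 0)) :
    Tendsto (fun R : ℕ => (R : ℝ)⁻¹ * ∑ x ∈ box 3 (2 * R), (bondPercolation (zdGraph 3) (criticalProbI 3)).real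
      (openConnIn {x : Site 3 | 0 ≤ x 0} 0 x ∩
        {ω | ∃ y : Site 3, (∃ i : Fin 3, (R : ℤ) ≤ |y i|) ∧ ω ∈ openConnIn {x : Site 3 | 0 ≤ x 0} 0 y} ∩
        {ω | ((((box 3 R).filter fun g : Site 3 => g 0 = 0 ∧
          ω ∈ openConnIn ((↑(box 3 R) : Set (Site 3)) ∩ {x : Site 3 | 0 ≤ x 0}) 0 g).card : ℕ) : ℝ) <
            (2 * (R : ℝ)) ^ φ})) atTop (𝓝 0) := by
  refine tendsto_of_tendsto_of_tendsto_of_le_of_le' tendsto_const_nhds hS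
    (Filter.Eventually.of_forall fun R => mul_nonneg (inv_nonneg.2 (Nat.cast_nonneg R))
      (Finset.sum_nonneg fun _ _ => measureReal_nonneg)) ?_
  refine Filter.eventually_atTop.2 ⟨1, fun R hR => ?_⟩
  have h2R : (1 : ℝ) ≤ 2 * (R : ℝ) := by
    have : (1 : ℝ) ≤ R := by exact_mod_cast hR
    linarith
  refine mul_le_mul_of_nonneg_left (Finset.sum_le_sum fun x _ => measureReal_mono ?_) (inv_nonneg.2 (Nat.cast_nonneg R))
  rintro ω ⟨hω, hthin⟩
  refine ⟨hω, ?_⟩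
  have hthin' : ((((box 3 R).filter fun g : Site 3 => g 0 = 0 ∧
      ω ∈ openConnIn ((↑(box 3 R) : Set (Site 3)) ∩ {x : Site 3 | 0 ≤ x 0}) 0 g).card : ℕ) : ℝ) <
        (2 * (R : ℝ)) ^ φ := hthin
  exact hthin'.trans_le (Real.rpow_le_rpow_of_exponent_le h2R hle)

/-! ## The crux from the two route-level inputs of the line -/

/-- **K from the line's two hypothesis-stubs, stated as explicit hypotheses.**  If the route's B yields `Bwide`
and there are `a`, `φ ≥ 0` with `a + φ > 7/4`, `C → QuantC a` and `StemLight φ`, then `LowPointBookkeeping`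
(A idle; `θ(p_c) = 0 ⇒` axis decay by `LowPoint.tendsto_real_openConn_axis_of_percolationContinuityZ3`).
These two hypotheses are exactly the registered stubs `stub_bwide_of_B`, `stub_stemInputs` of the skeleton
`Lines/SketchIdeator4.lean`: route-level inputs (the card's restatement R6), not consequences of A, B, C.
[folklore] -/
theorem lowPointBookkeeping_of_stemInputs
    (hBw : TallClusterMassBound → ∃ C : ℝ, ∀ r : ℕ, 1 ≤ r → ∑ x ∈ box 3 (4 * r),
      (bondPercolation (zdGraph 3) (criticalProbI 3)).real (openConnIn {x : Site 3 | 0 ≤ x 0} 0 x ∩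
        {ω | ∃ y : Site 3, (∃ i : Fin 3, (r : ℤ) ≤ |y i|) ∧ ω ∈ openConnIn {x : Site 3 | 0 ≤ x 0} 0 y}) ≤
      C * (r : ℝ) ^ ((11 : ℝ) / 4) * (bondPercolation (zdGraph 3) (criticalProbI 3)).real
        {ω | ∃ y : Site 3, (∃ i : Fin 3, (r : ℤ) ≤ |y i|) ∧ ω ∈ openConnIn {x : Site 3 | 0 ≤ x 0} 0 y})
    (hIn : ∃ a φ : ℝ, 0 ≤ φ ∧ (7 : ℝ) / 4 < a + φ ∧
      (QuantitativeBGN → ∃ C : ℝ, ∀ r : ℕ, 1 ≤ r → (bondPercolation (zdGraph 3) (criticalProbI 3)).real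
        {ω | ∃ y : Site 3, (∃ i : Fin 3, (r : ℤ) ≤ |y i|) ∧ ω ∈ openConnIn {x : Site 3 | 0 ≤ x 0} 0 y} ≤
          C * (r : ℝ) ^ (-a)) ∧
      Tendsto (fun R : ℕ => (R : ℝ)⁻¹ * ∑ x ∈ box 3 (2 * R), (bondPercolation (zdGraph 3) (criticalProbI 3)).real
        (openConnIn {x : Site 3 | 0 ≤ x 0} 0 x ∩
          {ω | ∃ y : Site 3, (∃ i : Fin 3, (R : ℤ) ≤ |y i|) ∧ ω ∈ openConnIn {x : Site 3 | 0 ≤ x 0} 0 y} ∩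
          {ω | ((((box 3 R).filter fun g : Site 3 => g 0 = 0 ∧
            ω ∈ openConnIn ((↑(box 3 R) : Set (Site 3)) ∩ {x : Site 3 | 0 ≤ x 0}) 0 g).card : ℕ) : ℝ) <
              (2 * (R : ℝ)) ^ φ})) atTop (𝓝 0)) :
    LowPointBookkeeping := by
  intro _hA hB hC
  obtain ⟨a, φ, hφ, haφ, hCq, hS⟩ := hIn
  exact LowPoint.tendsto_real_openConn_axis_of_percolationContinuityZ3
    (percolationContinuityZ3_of_stemInputs hφ haφ (hBw hB) (hCq hC) hS)

/-! ## Dominance: the R6 inputs imply the route's B and C -/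

/-- `Bwide ⇒ B`: the route's `TallClusterMassBound` (mass of `U ∩ B_r` on `arm_r`) follows from its wide-ball
re-typing (mass of `U ∩ B_{4r}` on `arm_r`), since `B_r ⊆ B_{4r}`. [folklore] -/
theorem tallClusterMassBound_of_bwide
    (hBw : ∃ C : ℝ, ∀ r : ℕ, 1 ≤ r → ∑ x ∈ box 3 (4 * r), (bondPercolation (zdGraph 3) (criticalProbI 3)).real
      (openConnIn {x : Site 3 | 0 ≤ x 0} 0 x ∩
        {ω | ∃ y : Site 3, (∃ i : Fin 3, (r : ℤ) ≤ |y i|) ∧ ω ∈ openConnIn {x : Site 3 | 0 ≤ x 0} 0 y}) ≤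
      C * (r : ℝ) ^ ((11 : ℝ) / 4) * (bondPercolation (zdGraph 3) (criticalProbI 3)).real
        {ω | ∃ y : Site 3, (∃ i : Fin 3, (r : ℤ) ≤ |y i|) ∧ ω ∈ openConnIn {x : Site 3 | 0 ≤ x 0} 0 y}) :
    TallClusterMassBound := by
  obtain ⟨C, hC⟩ := hBw
  refine ⟨C, fun r hr => le_trans ?_ (hC r hr)⟩
  exact Finset.sum_le_sum_of_subset_of_nonneg (Dyadic.box_subset_box (by omega))
    fun _ _ _ => measureReal_nonneg

/-- `QuantC a ⇒ C` for `a > 0`: the route's `QuantitativeBGN` is `∃ a > 0, QuantC a`. [folklore] -/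
theorem quantitativeBGN_of_quantC {a : ℝ} (ha : 0 < a)
    (hQ : ∃ C : ℝ, ∀ r : ℕ, 1 ≤ r → (bondPercolation (zdGraph 3) (criticalProbI 3)).real
      {ω | ∃ y : Site 3, (∃ i : Fin 3, (r : ℤ) ≤ |y i|) ∧ ω ∈ openConnIn {x : Site 3 | 0 ≤ x 0} 0 y} ≤
        C * (r : ℝ) ^ (-a)) :
    QuantitativeBGN := by
  obtain ⟨C, hC⟩ := hQ
  exact ⟨a, C, ha, hC⟩

end Summit.CriticalPhenomena.PercolationContinuityZ3.Theorems.StemCriterion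

end
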